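import Summits.HodgeConjecture.CorCM.Census.QuarticInversionNormalForm

/-!
# The quartic inversion twists, XIX: the closing lattice — pattern sums, the relations in literal form, the symbolic decomposition

COR-CM (cell `pub-hodgecm2`, stage 2 of the Hodge ladder), count-neutral KERNEL COMBINATORICS by the binder seat b23 (gen 44; claim
QUARTIC-INVERSION, HOME/INBOX.md l.12829).  Part XIX of the lane `Census/QuarticInversion*`, on top of parts I–XV, all BY NAME.
Bookkeeping definitions with bodies (`patEquiv`, `patIdx`, `tab16`, the tables `Bk`, `BCv`, `freeC`) + theorems; `decide` only on closed
identities of literal patterns / the bound of `patIdx`, no certificate, no named fact, no geometry, no `sorry` (tables by this folder's `work/gen/l8.py`).  `Interfaces.lean` (C1), every E term, B01, `Transposition/*`, `PortJoin/*` untouched.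
HONEST FRAMING: `HC_CM` is NOT proved, here or anywhere in the tree; nothing here is a period, a count of record or a headline.

CONTENT (`|B|` odd `≥ 3`, square class `ζ`, a slot datum `(P,u₁,u₂;Q,w,u₀)` and a cross datum `(σ,s₀)` as in part XVII).
* §1 Sums over patterns as sixteen literal terms; the relations of part XV in literal form (`rel01_lit`, `rel02_lit`, `rel03_lit`, `rel4_lit`).
* §2 **The symbolic decomposition**: a pair `(k, C)` satisfying oddness and `R1–R4` equals `Σ_l free_l • B_l` for eight explicit table
  vectors `B_l` with its eight free coordinates as coefficients (`kC_decomp`).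
  Part XX runs the finite check against the generator tables and concludes.  All [folklore].

## References
* [Pohlmann1968] H. Pohlmann, Algebraic cycles on abelian varieties of complex multiplication type, Ann. of Math. 88 (1968), Thm 1.
-/

namespace Summit.HodgeConjecture.CorCM.Census.QuarticInversion

open Finset
open Summit.HodgeConjecture.CorCM.Census.OddSliceFacesModel

noncomputable section

/-! ## §1 Pattern sums in literal form -/

/-- The patterns as quadruples of booleans. [folklore] -/
def patEquiv : (Bool × Bool × Bool × Bool) ≃ (Fin 4 → Bool) where
  toFun q := ![q.1, q.2.1, q.2.2.1, q.2.2.2]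
  invFun η := (η 0, η 1, η 2, η 3)
  left_inv q := by obtain ⟨a, b, c, d⟩ := q; rfl
  right_inv η := by funext n; fin_cases n <;> rfl

/-- A sum over all patterns is a fourfold sum over booleans. [folklore] -/
theorem sum_univ_pat (f : (Fin 4 → Bool) → ℤ) : ∑ η, f η = ∑ a, ∑ b, ∑ c, ∑ d, f ![a, b, c, d] := by
  rw [← Fintype.sum_equiv patEquiv (fun q => f (patEquiv q)) f (fun q => rfl)]
  simp only [Fintype.sum_prod_type]
  rfl

section Rel
variable (A : Type) [AddCommGroup A] [Fintype A] [DecidableEq A]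

/-- `R1` in literal form. [folklore] -/
theorem rel01_lit (hA : Odd (Fintype.card A)) {v : Ty₄ A → ℤ} (hv : v ∈ hodge₄ A) :
    kOf A 0 v + kOf A 1 v + (fnl A (wC A ![true, true, true, true]) v + fnl A (wC A ![true, true, true, false]) v +
      fnl A (wC A ![true, true, false, true]) v + fnl A (wC A ![true, true, false, false]) v) = 0 := by
  have h := rel_pair A hA hv 0 1
  rw [Finset.sum_filter, sum_univ_pat] at h
  simp only [Fintype.sum_bool, Matrix.cons_val_zero, Matrix.cons_val_one, and_true, and_false,
    if_true, if_false, Bool.false_eq_true, add_zero] at h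
  linarith

/-- `R2` in literal form. [folklore] -/
theorem rel02_lit (hA : Odd (Fintype.card A)) {v : Ty₄ A → ℤ} (hv : v ∈ hodge₄ A) :
    kOf A 0 v + kOf A 2 v + (fnl A (wC A ![true, true, true, true]) v + fnl A (wC A ![true, true, true, false]) v +
      fnl A (wC A ![true, false, true, true]) v + fnl A (wC A ![true, false, true, false]) v) = 0 := by
  have h := rel_pair A hA hv 0 2
  rw [Finset.sum_filter, sum_univ_pat] at h
  simp only [Fintype.sum_bool, Matrix.cons_val_zero, Matrix.cons_val_two, Matrix.tail_cons, Matrix.head_cons, and_true, and_false,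
    if_true, if_false, Bool.false_eq_true, add_zero] at h
  linarith

/-- `R3` in literal form. [folklore] -/
theorem rel03_lit (hA : Odd (Fintype.card A)) {v : Ty₄ A → ℤ} (hv : v ∈ hodge₄ A) :
    kOf A 0 v + kOf A 3 v + (fnl A (wC A ![true, true, true, true]) v + fnl A (wC A ![true, true, false, true]) v +
      fnl A (wC A ![true, false, true, true]) v + fnl A (wC A ![true, false, false, true]) v) = 0 := by
  have h := rel_pair A hA hv 0 3
  rw [Finset.sum_filter, sum_univ_pat] at h
  simp only [Fintype.sum_bool, Matrix.cons_val_zero, Matrix.cons_val_three, Matrix.tail_cons, Matrix.head_cons, and_true, and_false,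
    if_true, if_false, Bool.false_eq_true, add_zero] at h
  linarith

/-- `R4` in literal form. [folklore] -/
theorem rel4_lit (hA : Odd (Fintype.card A)) {v : Ty₄ A → ℤ} (hv : v ∈ hodge₄ A) :
    kOf A 0 v + kOf A 1 v + kOf A 2 v + kOf A 3 v =
      fnl A (wC A ![true, false, false, false]) v - fnl A (wC A ![true, true, true, false]) v - fnl A (wC A ![true, true, false, true]) v -
        fnl A (wC A ![true, false, true, true]) v - 2 * fnl A (wC A ![true, true, true, true]) v := by
  have h := rel_diag A hA hv
  rw [Finset.sum_filter, sum_univ_pat] at h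
  simp only [Fintype.sum_bool, Matrix.cons_val_zero, if_true, if_false, Bool.false_eq_true, add_zero, cnt, Fin.sum_univ_four,
    Matrix.cons_val_one, Matrix.head_cons, Matrix.cons_val_two, Matrix.tail_cons, Matrix.cons_val_three, Bool.true_eq_false] at h
  linarith

end Rel

/-! ## §2 Tables and the symbolic decomposition -/

/-- The binary index `η₀η₁η₂η₃` of a pattern (`true` = `1`). [folklore] -/
def patIdx (η : Fin 4 → Bool) : Fin 16 :=
  ⟨(bif η 0 then 8 else 0) + (bif η 1 then 4 else 0) + (bif η 2 then 2 else 0) + (bif η 3 then 1 else 0), by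
    cases η 0 <;> cases η 1 <;> cases η 2 <;> cases η 3 <;> decide⟩

/-- A table of sixteen integers read at a pattern. [folklore] -/
def tab16 (v : Fin 16 → ℤ) (η : Fin 4 → Bool) : ℤ := v (patIdx η)

/-- Two functions of patterns agree iff they agree on the sixteen literal patterns. [folklore] -/
theorem funext_pat {f g : (Fin 4 → Bool) → ℤ} (h : ∀ a b c d : Bool, f ![a, b, c, d] = g ![a, b, c, d]) : f = g := by
  funext η
  have eη : η = ![η 0, η 1, η 2, η 3] := by funext n; fin_cases n <;> rfl
  rw [eη]; exact h _ _ _ _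


/-- The column parts of the eight basis vectors of the relation lattice. [folklore] -/
def Bk : Fin 8 → Fin 4 → ℤ := ![![1, 0, 0, 0], ![0, 1, 0, 0], ![0, 0, 1, 0], ![0, 0, 0, 1], ![0, 0, 0, 0], ![0, 0, 0, 0], ![0, 0, 0, 0], ![0, 0, 0, 0]]

/-- The constant parts (as tables) of the eight basis vectors of the relation lattice. [folklore] -/
def BCv : Fin 8 → Fin 16 → ℤ := ![![0, 0, 0, 1, 0, 1, 1, -1, 1, -1, -1, 0, -1, 0, 0, 0],
  ![0, 0, 0, 1, 0, 0, 0, -1, 1, 0, 0, 0, -1, 0, 0, 0],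
  ![0, 0, 0, 0, 0, 1, 0, -1, 1, 0, -1, 0, 0, 0, 0, 0],
  ![0, 0, 0, 0, 0, 0, 1, -1, 1, -1, 0, 0, 0, 0, 0, 0],
  ![-1, 0, 0, 1, 0, 1, 1, -2, 2, -1, -1, 0, -1, 0, 0, 1],
  ![0, -1, 0, 1, 0, 1, 0, -1, 1, 0, -1, 0, -1, 0, 1, 0],
  ![0, 0, -1, 1, 0, 0, 1, -1, 1, -1, 0, 0, -1, 1, 0, 0],
  ![0, 0, 0, 0, -1, 1, 1, -1, 1, -1, -1, 1, 0, 0, 0, 0]]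

/-- The eight free coordinates `(k₀, k₁, k₂, k₃, C_TTTT, C_TTTF, C_TTFT, C_TFTT)`. [folklore] -/
def freeC (k : Fin 4 → ℤ) (C : (Fin 4 → Bool) → ℤ) : Fin 8 → ℤ :=
  ![k 0, k 1, k 2, k 3, C ![true, true, true, true], C ![true, true, true, false], C ![true, true, false, true], C ![true, false, true, true]]

/-- **The symbolic decomposition**: a pair satisfying oddness and `R1–R4` is `Σ_l free_l • B_l`. [folklore] -/
theorem kC_decomp (k : Fin 4 → ℤ) (C : (Fin 4 → Bool) → ℤ) (hodd : ∀ η : Fin 4 → Bool, C (fun n => !η n) = -C η)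
    (r1 : k 0 + k 1 + (C ![true, true, true, true] + C ![true, true, true, false] + C ![true, true, false, true] +
      C ![true, true, false, false]) = 0)
    (r2 : k 0 + k 2 + (C ![true, true, true, true] + C ![true, true, true, false] + C ![true, false, true, true] +
      C ![true, false, true, false]) = 0)
    (r3 : k 0 + k 3 + (C ![true, true, true, true] + C ![true, true, false, true] + C ![true, false, true, true] +
      C ![true, false, false, true]) = 0)
    (r4 : k 0 + k 1 + k 2 + k 3 = C ![true, false, false, false] - C ![true, true, true, false] - C ![true, true, false, true] -
      C ![true, false, true, true] - 2 * C ![true, true, true, true]) :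
    ((k, C) : (Fin 4 → ℤ) × ((Fin 4 → Bool) → ℤ)) = ∑ l : Fin 8, freeC k C l • (Bk l, tab16 (BCv l)) := by
  have o8 := hodd ![true, false, false, false]
  rw [show (fun n => !(![true, false, false, false] : Fin 4 → Bool) n) = ![false, true, true, true] from by decide] at o8
  have o9 := hodd ![true, false, false, true]
  rw [show (fun n => !(![true, false, false, true] : Fin 4 → Bool) n) = ![false, true, true, false] from by decide] at o9
  have o10 := hodd ![true, false, true, false]
  rw [show (fun n => !(![true, false, true, false] : Fin 4 → Bool) n) = ![false, true, false, true] from by decide] at o10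
  have o11 := hodd ![true, false, true, true]
  rw [show (fun n => !(![true, false, true, true] : Fin 4 → Bool) n) = ![false, true, false, false] from by decide] at o11
  have o12 := hodd ![true, true, false, false]
  rw [show (fun n => !(![true, true, false, false] : Fin 4 → Bool) n) = ![false, false, true, true] from by decide] at o12
  have o13 := hodd ![true, true, false, true]
  rw [show (fun n => !(![true, true, false, true] : Fin 4 → Bool) n) = ![false, false, true, false] from by decide] at o13
  have o14 := hodd ![true, true, true, false]
  rw [show (fun n => !(![true, true, true, false] : Fin 4 → Bool) n) = ![false, false, false, true] from by decide] at o14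
  have o15 := hodd ![true, true, true, true]
  rw [show (fun n => !(![true, true, true, true] : Fin 4 → Bool) n) = ![false, false, false, false] from by decide] at o15
  refine Prod.ext ?_ ?_
  · funext j
    simp only [Fin.sum_univ_eight, freeC, Bk]
    fin_cases j <;> simp
  · refine funext_pat fun a b c d => ?_
    simp only [Fin.sum_univ_eight, freeC, BCv]
    cases a <;> cases b <;> cases c <;> cases d <;> simp [tab16, patIdx] <;> linarith


end

end Summit.HodgeConjecture.CorCM.Census.QuarticInversion
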